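import Summits.QuantumFields.BalabanUV.T4Continuum.Support.NE3DressedBlockField
import HarnessLib

/-!
# T⁴ programme, node NE3 — row E-MLw-(w4)-P-curved, route H♮, row K5c (kit 2): CORNER SPIKES — the spike field of a coarse height,
# its values on a block, its transported block mean, periodicity, and its covariant energy `≤ 4d·Σ‖h‖²`

NE3 (node U1b) formalisation swarm, leaf seat `b2b-balaban-t4-ne3-formalise-leaf-01` (gen 6); row **K5** of ruling ρ-g22-2
(`HOME/t4/b2b-balaban-t4-ne3-p1/g22/D-ne3p1-g22-1.md` §2 S7 «ζ̃′ := I_W(m) + Σ_z h_z·δ_{M•z}», remark A2 «the spikes MUST go through `h_z`»;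
owner ρ-g23-4: `h_z = s_z = ζ′(M•z) − (nested mean) = −framePotW(η′)`), sub-row **K5c** (FINDING F-ne3leaf01g6-1 ∕ INTENT,
`HOME/CLAIMS.log` 2026-08-20 ≈18:08Z ∕ ≈18:15Z).  Kit for the competitor file `NE3CovariantCompetitor`.  Over NE3-R2's ∕ leaf-02-g5's
`bmeanW` (`NE3CovariantBlockMean`) and the lineage's K5b-1 `NE3DressedBlockField` (`cdiv_corner`) BY NAME.

CONTENT ([folklore]; 0 sorry; DATA defs `spikeW`, `r0`): `spikeW M h y := h (cdiv M y)` at corners (`cmod M y = 0`), else `0`;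
`spikeW_corner`, `spikeW_block` (on the block of `z`: `h z` at offset `0`, `0` elsewhere), `spikeW_mem_skewAdjoint`, `spikeW_add_period`,
**`bmeanW_spikeW`** (`bmeanW M W (spikeW M h) z = (M^d)⁻¹ • h z` — the corner is transported by the empty word), `sum_block_normSq_spikeW`,
**`sum_normSq_gaugeDir_spikeW_le`** (`Σ_{y∈periodBox(M·N)} Σ_α ‖gaugeDir W (spikeW M h) y α‖² ≤ 4d·Σ_{z∈periodBox N} ‖h z‖²` — each spike
touches `2d` bonds; NO `M^{d−2}` factor).

HONEST FRAMING.  Kinematics of OUR competitor at one background; nothing about Bałaban's minimisers; (P♮)_W ∕ (ML_w) at W ≠ 1, T-E_w and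
**NE3 are NOT proved**; spine PROVED 0∕9; finite T⁴ rung (B)+1 — NOT infinite volume, NOT mass gap, NOT `BetaPertH`, NOT Clay.  PLACEMENT:
`Summits/QuantumFields/BalabanUV/`.  HONEST DEPENDENCY (cell page 1): continuum YM on T⁴ ⇐ BetaPertH ∧ nine spine estimates (0/9 proved);
BetaPertH ⇐ (D1) ∧ (D4) ∧ CAP+tail; G-an2-4 gates asym, D1 and NE2/3/4.
-/

set_option autoImplicit false

open scoped BigOperators Matrix.Norms.L2Operator
open Finset

namespace Summit.QuantumFields.BalabanUV.T4Continuum.NE3CornerSpikes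

open Literature.MathematicalPhysics.QuantumFieldTheory.Balaban1983to89
open B7Prop1Explicit B7Prop2Explicit
open T4AveragingDeficitWall (IsUnitaryCfg SmallField Ad)
open T4AveragingDeficitWallBoundary (periodBox mem_periodBox card_periodBox IsPeriodicCfg sum_periodBox_shift)
open AveragingDeficitTransport (norm_Ad_of_unitary)
open AveragingDeficitNearIdentity (Ad_one Ad_zero)
open SkeletonLattice (cdiv cmod smul_cdiv_add_cmod cdiv_add_period cmod_add_period)
open BlockAveragePushDirGauge (gaugeDir)
open NE3BlockLineAverage (sum_periodBox_blocks sum_univ_boxVec)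
open NE3CovariantBlockMean (bmeanW cdiv_cmod_block)
open NE3DressedBlockField (cdiv_corner)

noncomputable section

variable {d : ℕ} {n : Type*} [Fintype n] [DecidableEq n]

/-! ## §1 Corner spikes -/

/-- THE CORNER SPIKE FIELD of height `h`: `h (cdiv M y)` at the block corners (`cmod M y = 0`), `0` elsewhere. [folklore] -/
def spikeW (M : ℕ) (h : Site d → Matrix n n ℂ) (y : Site d) : Matrix n n ℂ := if cmod M y = 0 then h (cdiv M y) else 0

/-- The zero offset. [folklore] -/
def r0 {M : ℕ} (hM : 1 ≤ M) : Fin d → Fin M := fun _ => ⟨0, by omega⟩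

/-- `boxVec M r0 = 0`. [folklore] -/
theorem boxVec_r0 {M : ℕ} (hM : 1 ≤ M) : boxVec M (r0 (d := d) hM) = 0 := by
  funext κ; simp [boxVec, r0]

/-- `boxVec M r = 0 ↔ r = r0`. [folklore] -/
theorem boxVec_eq_zero_iff {M : ℕ} (hM : 1 ≤ M) (r : Fin d → Fin M) : boxVec M r = 0 ↔ r = r0 hM := by
  constructor
  · intro h; rw [← boxVec_r0 hM] at h; exact T4TermwiseTorus.boxVec_injective M h
  · rintro rfl; exact boxVec_r0 hM

/-- `cmod M (M•z) = 0`. [folklore] -/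
theorem cmod_corner {M : ℕ} (hM : 1 ≤ M) (z : Site d) : cmod M ((M : ℤ) • z) = 0 := by
  have h := smul_cdiv_add_cmod (L := M) ((M : ℤ) • z)
  rw [cdiv_corner hM] at h
  simpa using h

omit [Fintype n] [DecidableEq n] in
/-- **THE SPIKE AT A CORNER**: `spikeW M h (M•z) = h z` (`M ≥ 1`). [folklore] -/
theorem spikeW_corner {M : ℕ} (hM : 1 ≤ M) (h : Site d → Matrix n n ℂ) (z : Site d) : spikeW M h ((M : ℤ) • z) = h z := by
  unfold spikeW; rw [if_pos (cmod_corner hM z), cdiv_corner hM]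

omit [Fintype n] [DecidableEq n] in
/-- The spike on the block of `z`: `h z` at the offset `0`, `0` at every other offset. [folklore] -/
theorem spikeW_block {M : ℕ} (hM : 1 ≤ M) (h : Site d → Matrix n n ℂ) (z : Site d) (r : Fin d → Fin M) :
    spikeW M h ((M : ℤ) • z + boxVec M r) = if r = r0 hM then h z else 0 := by
  obtain ⟨hc, hm⟩ := cdiv_cmod_block M z r
  unfold spikeW
  rw [hm, hc]
  by_cases hr : r = r0 hM
  · rw [if_pos hr, if_pos ((boxVec_eq_zero_iff hM r).2 hr)]
  · rw [if_neg hr, if_neg (mt (boxVec_eq_zero_iff hM r).1 hr)]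

omit [Fintype n] [DecidableEq n] in
/-- The spike field of 𝔲(n)-valued heights is 𝔲(n)-valued. [folklore] -/
theorem spikeW_mem_skewAdjoint (M : ℕ) {h : Site d → Matrix n n ℂ} (hh : ∀ z, h z ∈ skewAdjoint (Matrix n n ℂ)) (y : Site d) :
    spikeW M h y ∈ skewAdjoint (Matrix n n ℂ) := by
  unfold spikeW; split_ifs
  · exact hh _
  · exact (skewAdjoint (Matrix n n ℂ)).zero_mem

omit [Fintype n] [DecidableEq n] in
/-- Periodicity: an `N`-periodic height gives an `(M·N)`-periodic spike field (`M ≥ 1`). [folklore] -/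
theorem spikeW_add_period {M : ℕ} (hM : 1 ≤ M) {N : ℕ} {h : Site d → Matrix n n ℂ}
    (hh : ∀ (z : Site d) (τ : Fin d), h (z + (N : ℤ) • e τ) = h z) (y : Site d) (τ : Fin d) :
    spikeW M h (y + ((M * N : ℕ) : ℤ) • e τ) = spikeW M h y := by
  have hP : ((M * N : ℕ) : ℤ) = (M : ℤ) * (N : ℤ) := by push_cast; ring
  unfold spikeW
  rw [hP, cmod_add_period (L := M) (N : ℤ) y τ, cdiv_add_period hM (N : ℤ) y τ, hh]

/-- **THE TRANSPORTED BLOCK MEAN OF A SPIKE FIELD**: `bmeanW M W (spikeW M h) z = (M^d)⁻¹ • h z` (`M ≥ 1`; the corner is transported by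
the empty tree word). [folklore] -/
theorem bmeanW_spikeW {M : ℕ} (hM : 1 ≤ M) (W : Site d → Fin d → (Matrix n n ℂ)ˣ) (h : Site d → Matrix n n ℂ) (z : Site d) :
    bmeanW M W (spikeW M h) z = (((M : ℝ) ^ d)⁻¹ : ℝ) • h z := by
  unfold bmeanW
  rw [Finset.sum_eq_single (r0 hM)]
  · rw [spikeW_block hM, if_pos rfl, boxVec_r0 hM, treeWord_zero, hol_nil, Ad_one]
  · intro r _ hr
    rw [spikeW_block hM, if_neg hr, Ad_zero, smul_zero]
  · intro h0; exact absurd (Finset.mem_univ _) h0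

/-- The spike field over one block: `Σ_{v∈[0,M)^d} ‖spikeW M h (M•z + v)‖² = ‖h z‖²` (`M ≥ 1`). [folklore] -/
theorem sum_block_normSq_spikeW {M : ℕ} (hM : 1 ≤ M) (h : Site d → Matrix n n ℂ) (z : Site d) :
    ∑ v ∈ periodBox (d := d) M, ‖spikeW M h ((M : ℤ) • z + v)‖ ^ 2 = ‖h z‖ ^ 2 := by
  rw [← sum_univ_boxVec M (fun v => ‖spikeW M h ((M : ℤ) • z + v)‖ ^ 2), Finset.sum_eq_single (r0 hM)]
  · rw [spikeW_block hM, if_pos rfl]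
  · intro r _ hr
    rw [spikeW_block hM, if_neg hr, norm_zero]; ring
  · intro h0; exact absurd (Finset.mem_univ _) h0

/-- **THE COVARIANT ENERGY OF A SPIKE FIELD** (`M, N ≥ 1`, `W` unitary, `h` `N`-periodic):
`Σ_{y∈periodBox(M·N)} Σ_α ‖gaugeDir W (spikeW M h) y α‖² ≤ 4d·Σ_{z∈periodBox N} ‖h z‖²` — each spike touches `2d` bonds. [folklore] -/
theorem sum_normSq_gaugeDir_spikeW_le [Nonempty n] {M N : ℕ} (hM : 1 ≤ M) (hN : 1 ≤ N) {W : Site d → Fin d → (Matrix n n ℂ)ˣ}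
    (hW : IsUnitaryCfg W) {h : Site d → Matrix n n ℂ} (hh : ∀ (z : Site d) (τ : Fin d), h (z + (N : ℤ) • e τ) = h z) :
    ∑ y ∈ periodBox (d := d) (M * N), ∑ α : Fin d, ‖gaugeDir W (spikeW M h) y α‖ ^ 2
      ≤ 4 * (d : ℝ) * ∑ z ∈ periodBox (d := d) N, ‖h z‖ ^ 2 := by
  have hMN : 1 ≤ M * N := Nat.one_le_iff_ne_zero.mpr (Nat.mul_ne_zero (by omega) (by omega))
  -- pointwise
  have hpt : ∀ (y : Site d) (α : Fin d), ‖gaugeDir W (spikeW M h) y α‖ ^ 2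
      ≤ 2 * ‖spikeW M h y‖ ^ 2 + 2 * ‖spikeW M h (y + e α)‖ ^ 2 := by
    intro y α
    have h1 : ‖gaugeDir W (spikeW M h) y α‖ ≤ ‖spikeW M h y‖ + ‖spikeW M h (y + e α)‖ := by
      unfold gaugeDir
      refine (norm_sub_le _ _).trans ?_
      rw [norm_Ad_of_unitary ((unitaryUnits _).inv_mem (hW y α))]
    calc ‖gaugeDir W (spikeW M h) y α‖ ^ 2 ≤ (‖spikeW M h y‖ + ‖spikeW M h (y + e α)‖) ^ 2 := pow_le_pow_left₀ (norm_nonneg _) h1 2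
      _ ≤ _ := by nlinarith [sq_nonneg (‖spikeW M h y‖ - ‖spikeW M h (y + e α)‖)]
  -- the spike energy over one period
  have hS : ∑ y ∈ periodBox (d := d) (M * N), ‖spikeW M h y‖ ^ 2 = ∑ z ∈ periodBox (d := d) N, ‖h z‖ ^ 2 := by
    rw [← sum_periodBox_blocks M N hM]
    exact Finset.sum_congr rfl fun z _ => sum_block_normSq_spikeW hM h z
  have hshift : ∀ α : Fin d, ∑ y ∈ periodBox (d := d) (M * N), ‖spikeW M h (y + e α)‖ ^ 2
      = ∑ y ∈ periodBox (d := d) (M * N), ‖spikeW M h y‖ ^ 2 :=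
    fun α => sum_periodBox_shift (M * N) hMN (g := fun y => ‖spikeW M h y‖ ^ 2)
      (fun x κ => by simp only [spikeW_add_period hM hh]) (e α)
  calc ∑ y ∈ periodBox (d := d) (M * N), ∑ α : Fin d, ‖gaugeDir W (spikeW M h) y α‖ ^ 2
      ≤ ∑ y ∈ periodBox (d := d) (M * N), ∑ α : Fin d, (2 * ‖spikeW M h y‖ ^ 2 + 2 * ‖spikeW M h (y + e α)‖ ^ 2) :=
        Finset.sum_le_sum fun y _ => Finset.sum_le_sum fun α _ => hpt y α
    _ = ∑ α : Fin d, (2 * ∑ y ∈ periodBox (d := d) (M * N), ‖spikeW M h y‖ ^ 2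
          + 2 * ∑ y ∈ periodBox (d := d) (M * N), ‖spikeW M h (y + e α)‖ ^ 2) := by
        rw [Finset.sum_comm]
        simp only [Finset.sum_add_distrib, Finset.mul_sum]
    _ = 4 * (d : ℝ) * ∑ z ∈ periodBox (d := d) N, ‖h z‖ ^ 2 := by
        simp only [hshift, hS, Finset.sum_const, Finset.card_univ, Fintype.card_fin, nsmul_eq_mul]
        ring


end

end Summit.QuantumFields.BalabanUV.T4Continuum.NE3CornerSpikes
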